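import Literature.AlgebraicGeometry.FormalGeometry.WittGEUnitBoundStepII
import Literature.AlgebraicGeometry.Motives.GrothendieckExistenceWittProofs
import HarnessLib

/-!
# Grothendieck's existence theorem for vector bundles on proper `W(k)`-schemes — the named facts hold

Row b03 / crux `AnchorTransport.VariationalHodge` (stmt-HodgeConjecture-1076), line padic-disc-transport,
STUB P (`…_of_grothendieckExistence` rungs). With Grothendieck's existence theorem for proper schemes
in the kernel (`GrothendieckExistenceProper.exists_coh_iso_cmplTower_of_isProper`,
`…GrothendieckExistenceUnitBoundStepII`), the vector-bundle form follows exactly as in the projective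
case (`Motives/GrothendieckExistenceWittProjective`): the direct images `ι_{n+1*}E_n` of a compatible
system of vector bundles on the thickenings `𝒳 ⊗ W/pⁿ⁺¹` form a coherent formal tower along `p`
(`coh_tower_of_formalVectorBundle`), its algebraization `F` is a vector bundle with `F|_{X_{n+1}} ≅ E_n`
(`isVectorBundle_and_iso_of_cokernelIsos`, `pullbackThickeningιIso`).

* `exists_isVectorBundle_forall_pullback_thickeningι_iso` — GW II Thm. 24.94 + Prop. 24.95 for vector
  bundles on EVERY proper `𝒳 / W(k)` (`k` perfect of characteristic `p`, any universe), all levels;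
* the FOUR vendored shapes of the theorem ("web of vendored variants",
  `Motives/GrothendieckExistenceWittProofs`) are discharged under their EXACT names:
  **`Literature.AlgebraicGeometry.Motives.GrothendieckExistence_vectorBundle_witt_holds`** (level one,
  any universe), **`Literature.AlgebraicGeometry.Deformation.GortzWedhorn2023_thm2494_vectorBundle_witt_holds`**
  (all levels, `k : Type`), **`Literature.AlgebraicGeometry.FormalGeometry.GortzWedhorn2023_prop2495_wittVector_holds`**
  (`LiftsFormally → LiftsTo`, proper `𝒳`) and
  **`Literature.AlgebraicGeometry.FormalGeometry.GortzWedhorn2023_prop_24_95_wittModel_liftsTo_of_liftsFormally_holds`**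
  (smooth proper `W(k)`-models, any universe) — the named facts are THEOREMS.

HONEST FRAMING: research route conditional on HC_CM; not a corollary; Q11.4-sentence-2 already
refuted in dim ≥ 3. Nothing here bears on `HC_CM`; no case of the Hodge conjecture is proved.

References: GortzWedhorn2023 (II: Thm. 24.94, Prop. 24.95, Lemma 24.96, pp. 566–567); EGAIII1
(Thm. 5.1.4, Cor. 5.2.4); StacksProject (Tag 088C).

Provenance: Literature home (family `hodge`, layer `Literature/AlgebraicGeometry/FormalGeometry`, namespace
`Literature.AlgebraicGeometry.FormalGeometry.WittGrothendieckExistence…`) of the Summits-side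
`Theorems/AnchorTransportVariationalHodgePadicGrothendieckExistenceVectorBundlesWitt{,Variants}` (route
`PadicSemiregularLift` / `AnchorTransport`, Grothendieck existence for vector bundles over `W(k)`), which
`Literature/` may not import; theorems only, no named fact, no definition. The four discharges carry EXACTLY the
fully qualified names `<fact>_holds` (the two outside this directory's namespace are declared with their
absolute `_root_.…` names, lean/CONVENTIONS.md §2); the Summits twins live under `Summit.….Theorems.GrothendieckExistenceProper`
and every in-tree use of them is namespace-resolved (dotted or in-namespace), so no ambiguity arises.
Lane `lit-hodgefound`, seat p20.
-/

noncomputable section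

-- `TopCat.Presheaf`/`Scheme.Modules` are not reducible (as in Mathlib's `AlgebraicGeometry/Modules`).
set_option backward.isDefEq.respectTransparency false

open CategoryTheory CategoryTheory.Limits _root_.AlgebraicGeometry TopologicalSpace Opposite
open Literature.AlgebraicGeometry.Modules Literature.AlgebraicGeometry.Morphisms
open Literature.AlgebraicGeometry.Motives Literature.AlgebraicGeometry.Motives.WittScheme

universe u

namespace Literature.AlgebraicGeometry.FormalGeometry.WittGrothendieckExistence

namespace GrothendieckExistenceProper

/-- **Grothendieck's existence theorem for vector bundles on a PROPER `W(k)`-scheme** (GW II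
Thm. 24.94 with Prop. 24.95, general proper case; no smoothness, flatness or projectivity): for
`𝒳 / W(k)` proper (`k` perfect of characteristic `p`) and vector bundles `E_n` on the thickenings
`X_{n+1} = 𝒳 ⊗_W W/pⁿ⁺¹` with `E_{n+1}|_{X_{n+1}} ≅ E_n`, there is a vector bundle `F` on `𝒳` with
`E_n ≅ F|_{X_{n+1}}` for all `n`. [cite: GortzWedhorn2023, proof of Thm. 24.94 and Prop. 24.95 (pp. 566–567), auxiliary step] -/
theorem exists_isVectorBundle_forall_pullback_thickeningι_iso {p : ℕ} [Fact p.Prime] {k : Type u}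
    [Field k] [CharP k p] [PerfectRing k p] (𝒳 : SchemeOver (WittVector p k)) [IsProper 𝒳.hom]
    (E : ∀ n : ℕ, (thickening 𝒳 (n + 1)).left.Modules) (hE : ∀ n, IsVectorBundle (E n))
    (hcompat : ∀ n, Nonempty ((Scheme.Modules.pullback
      (thickeningMap 𝒳 (Nat.le_succ (n + 1)))).obj (E (n + 1)) ≅ E n)) :
    ∃ F : 𝒳.left.Modules, IsVectorBundle F ∧
      ∀ n : ℕ, Nonempty (E n ≅ (Scheme.Modules.pullback (thickeningι 𝒳 (n + 1))).obj F) := by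
  haveI : IsLocallyNoetherian 𝒳.left := LocallyOfFiniteType.isLocallyNoetherian 𝒳.hom
  -- the direct-image tower `M_n = ι_{n+1*} E_n` along `a = p·1`
  obtain ⟨hcoh, hkill, htrans⟩ := coh_tower_of_formalVectorBundle 𝒳 E hE hcompat
  have hpow : ∀ m, algebraMapΓ 𝒳.hom ((p : WittVector p k) ^ m) =
      algebraMapΓ 𝒳.hom (p : WittVector p k) ^ m := algebraMapΓ_pow 𝒳
  let a : Γ(𝒳.left, ⊤) := algebraMapΓ 𝒳.hom (p : WittVector p k)
  let M : ℕ → 𝒳.left.Modules := fun n =>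
    (Scheme.Modules.pushforward (thickeningι 𝒳 (n + 1))).obj (E n)
  let β : ∀ n, cokernel (globalScalar (M (n + 1)) (a ^ (n + 1))) ≅ M n := fun n =>
    cokernelIsoOfEq (by rw [hpow]) ≪≫ (htrans n).some
  have hk' : ∀ n, globalScalar (M n) (a ^ (n + 1)) = 0 := fun n => by rw [← hpow]; exact hkill n
  have hT : IsFormalTower a (towerOfIsos a M β) := IsFormalTower.ofIsos _ M β hk'
  have hTc : ∀ n, Coh ((towerOfIsos a M β).obj ⟨n⟩) := fun n => hcoh n
  -- algebraize the tower: Grothendieck's existence theorem for the proper `𝒳`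
  obtain ⟨F, hF, ⟨eF⟩⟩ := exists_coh_iso_cmplTower_of_isProper 𝒳.hom (p : WittVector p k) hT hTc
  have hFfp : SheafOfModules.IsFinitePresentation.{u, u, u} F := isFinitePresentation_of_coh F hF
  -- levelwise `F/pⁿ⁺¹F ≅ ι_{n+1*} E_n`, and back to the restriction model
  have β' : ∀ n, cokernel (globalScalar F (algebraMapΓ 𝒳.hom ((p : WittVector p k) ^ (n + 1)))) ≅
      (Scheme.Modules.pushforward (thickeningι 𝒳 (n + 1))).obj (E n) := fun n =>
    cokernelIsoOfEq (by rw [hpow]) ≪≫ eF.app ⟨n⟩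
  obtain ⟨hFvb, -⟩ := isVectorBundle_and_iso_of_cokernelIsos 𝒳 E hE F hFfp β'
  exact ⟨F, hFvb, fun n => ⟨(pullbackThickeningιIso (n + 1) F (β' n)).symm⟩⟩

end GrothendieckExistenceProper

end Literature.AlgebraicGeometry.FormalGeometry.WittGrothendieckExistence

namespace Literature.AlgebraicGeometry.FormalGeometry

open WittGrothendieckExistence

/-- **`Motives.GrothendieckExistence_vectorBundle_witt` is a theorem** (Görtz–Wedhorn II Thm. 24.94
with Prop. 24.95 — Grothendieck's existence theorem for vector bundles — for EVERY proper
`𝒳 / W(k)`, `k` perfect of characteristic `p`, in every universe): a compatible system of vector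
bundles on the thickenings `𝒳 ⊗ W/pⁿ⁺¹` is, at level `1`, the restriction of a vector bundle on `𝒳`.
EXACT-name discharge of the named fact of `Motives/GrothendieckExistenceWitt` (declared with its
absolute name from this directory, lean/CONVENTIONS.md §2). [cite: GortzWedhorn2023, Thm. 24.94 and Prop. 24.95 (p. 566), Lemma 24.96 (p. 567)] -/
theorem _root_.Literature.AlgebraicGeometry.Motives.GrothendieckExistence_vectorBundle_witt_holds :
    Motives.GrothendieckExistence_vectorBundle_witt.{u} := by
  intro p _ k _ _ _ 𝒳 h𝒳 E hE hstep
  haveI := h𝒳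
  obtain ⟨F, hF, e⟩ :=
    GrothendieckExistenceProper.exists_isVectorBundle_forall_pullback_thickeningι_iso 𝒳 E hE hstep
  exact ⟨F, hF, ⟨(e 0).some.symm⟩⟩

/-- **`Deformation.GortzWedhorn2023_thm2494_vectorBundle_witt` is a theorem** (Görtz–Wedhorn II
Thm. 24.94 with Prop. 24.95 for finite locally free modules on a PROPER `W(k)`-scheme, `k` perfect of
characteristic `p`, ALL levels, `k : Type`): a compatible system `(E n)` of vector bundles on the
thickenings `𝒳 ⊗ W/pⁿ⁺¹` is `(F|_{X_{n+1}})_n` for a vector bundle `F` on `𝒳`. One line from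
`GrothendieckExistenceProper.exists_isVectorBundle_forall_pullback_thickeningι_iso` (isomorphisms
reversed). EXACT-name discharge (absolute name, lean/CONVENTIONS.md §2). [cite: GortzWedhorn2023, Thm. 24.94 and Prop. 24.95 (p. 566), Lemma 24.96 (p. 567)] -/
theorem _root_.Literature.AlgebraicGeometry.Deformation.GortzWedhorn2023_thm2494_vectorBundle_witt_holds :
    Deformation.GortzWedhorn2023_thm2494_vectorBundle_witt := by
  intro p _ k _ _ _ 𝒳 h𝒳 E hE hstep
  haveI := h𝒳
  obtain ⟨F, hF, e⟩ :=
    GrothendieckExistenceProper.exists_isVectorBundle_forall_pullback_thickeningι_iso 𝒳 E hE hstep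
  exact ⟨F, hF, fun n => ⟨(e n).some.symm⟩⟩

/-- **`FormalGeometry.GortzWedhorn2023_prop2495_wittVector` is a theorem** (GW II Prop. 24.95 for
proper `W(k)`-schemes, the `FormalGeometry` vendored form `LiftsFormally → LiftsTo`; it follows from
the universe-`0` `Motives` form by
`GortzWedhorn2023_prop2495_wittVector.of_grothendieckExistence_vectorBundle_witt`). EXACT-name
discharge. [cite: GortzWedhorn2023, Prop. 24.95 with Thm. 24.94 (p. 566)] -/
theorem GortzWedhorn2023_prop2495_wittVector_holds : GortzWedhorn2023_prop2495_wittVector :=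
  GortzWedhorn2023_prop2495_wittVector.of_grothendieckExistence_vectorBundle_witt
    Motives.GrothendieckExistence_vectorBundle_witt_holds.{0}

/-- **`FormalGeometry.GortzWedhorn2023_prop_24_95_wittModel_liftsTo_of_liftsFormally` is a theorem**
(Görtz–Wedhorn II Prop. 24.95, essential surjectivity, on smooth proper `W(k)`-models, every universe:
`LiftsFormally 𝒳 E₁ → LiftsTo 𝒳 E₁`): the `Motives` form implies it
(`Motives.GrothendieckExistence_vectorBundle_witt.prop_24_95_wittModel`, only properness is used), and
that form holds. EXACT-name discharge. [cite: GortzWedhorn2023, Prop. 24.95 (p. 566)] -/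
theorem GortzWedhorn2023_prop_24_95_wittModel_liftsTo_of_liftsFormally_holds :
    GortzWedhorn2023_prop_24_95_wittModel_liftsTo_of_liftsFormally.{u} :=
  Motives.GrothendieckExistence_vectorBundle_witt.prop_24_95_wittModel
    Motives.GrothendieckExistence_vectorBundle_witt_holds.{u}

end Literature.AlgebraicGeometry.FormalGeometry

end
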